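import Mathlib
import HarnessLib
import Summits.Parity.Statement
import Summits.Parity.GeneralizedHardyLittlewood.Theses.ClusterGapCarving

/-!
# Assembly of route-Parity-ClusterGapCarving (item stmt-Parity-26755)

`Assembly : FarSomePair → PairSync → TwinResidualRel → BiasDichotomy → TwinLowerFromPairSync → GeneralizedHardyLittlewood` is literally the route's certified deciding theorem `closes`
(node G3 «ClusterGapCarving» (decomp-parity lens-6 g2; rev 0)): far pairs + pair synchronisation give the twin HL asymptotic, the residual relative transfer and the bias dichotomy lift it to GHL.  One line; no mathematics beyond the route file.
-/

namespace Summit.Parity.GeneralizedHardyLittlewood.Theses.ClusterGapCarving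

/-- Assembly item stmt-Parity-26755 of route-Parity-ClusterGapCarving:
`FarSomePair → PairSync → TwinResidualRel → BiasDichotomy → TwinLowerFromPairSync → GeneralizedHardyLittlewood`,
by the route's deciding theorem `closes`. -/
theorem assembly_proof : Assembly :=
  fun h1 h2 h3 h4 h5 => closes h1 h2 h3 h4 h5

end Summit.Parity.GeneralizedHardyLittlewood.Theses.ClusterGapCarving
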